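import Summits.NavierStokesRegularity.Statement
import Summits.NavierStokesRegularity.NavierStokesRegularity.Theses.PlaneEnergyCeiling
import Summits.NavierStokesRegularity.NavierStokesRegularity.Theses.TerminalTrace
import Summits.NavierStokesRegularity.NavierStokesRegularity.Theses.HardyPointSink
import Summits.NavierStokesRegularity.NavierStokesRegularity.Theorems.PlaneEnergyCeilingPlanarEnergyAPrioriScar
import Summits.NavierStokesRegularity.NavierStokesRegularity.Theorems.PlaneEnergyCeilingPlanarEnergyAPrioriHardyCeiling
import Summits.NavierStokesRegularity.NavierStokesRegularity.Theorems.PlaneEnergyCeilingPlanarEnergyAPrioriTraceEdge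
import Summits.NavierStokesRegularity.NavierStokesRegularity.Theorems.FrozenSignCascadeBoundedEnvelopeContinuationClayOfBackwardBounded
import HarnessLib

/-!
# Strategist r1 sketch — crux `PlanarEnergyAPriori` (stmt-NavierStokesRegularity-16855), route PlaneEnergyCeiling

Typed content of `STRATEGY-CENSUS-r1.md` (redirect strategist r1, 2026-08-17). Nothing here is a route
item; nothing here restates or weakens the crux. Sections:

* §D  the candidate DECOMPOSITIONS of the census, as `def`s with their (trivial-seam) assemblies proved,
      and the landed fact that piece 1 of each is a CONSEQUENCE of the crux;
* §B2 a new cross-route closing, PROVED: `PlanarEnergyAPriori ∧ TerminalTrace.MorreyCellCriterion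
      (stmt-18615, a support-level stub of TerminalTrace) ⇒ NavierStokesRegularity` — strictly fewer
      hypotheses than the landed `…AltClosingTrace` (which consumes the whole crux 18614): under the
      planar crux every top point carries the Type-I scaled-energy bound that 18615 asks for
      (`PlanarEnergyAPriori.scaledEnergy_bound`) and the vanishing final density
      (`noTraceConcentration_of_planarEnergyAPriori`);
* §B1/B3/B4 further consequences / reformulations of the crux, as `def`s (claimed, proof sketches in
      the census): energy continuity at the top time, CKN in-plane islands, single-direction ceiling.
-/

noncomputable section

-- Problem = summit for this single-conjunct summit: the duplicate namespace component is deliberate.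
set_option linter.dupNamespace false

namespace Summit.NavierStokesRegularity.NavierStokesRegularity.Cruxes.PlanarEnergyAPriori.StrategistR1

open Summit.NavierStokesRegularity.NavierStokesRegularity
open Summit.NavierStokesRegularity.NavierStokesRegularity.Theorems.PlanarEnergyAPriori
open Literature.Analysis.FluidPDE MeasureTheory Metric Set Filter Topology
open scoped ENNReal NNReal

/-- The crux, by name. -/
abbrev Crux : Prop := Theses.PlaneEnergyCeiling.PlanarEnergyAPriori

/-! ## §D Decompositions (census `## Decomposition`) -/

/-- D1 piece 1 — **no Type II in the energy sense along frame solutions**: uniformly bounded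
Caffarelli–Kohn–Nirenberg scaled energy `r⁻¹ ∫_{B_r(x₀)} |u(t)|² ≤ A` at all centres, radii and
times `t < T`. A CONSEQUENCE of the crux (`d1_piece1_of_crux`); its unconditional proof is the
exclusion of energy-sense Type-II blow-up from Schwartz data (open; known only in no class beyond
"regular"). -/
def ScaledEnergyAPriori : Prop :=
  ∀ (ν T : ℝ), 0 < ν → 0 < T → ∀ (u : ℝ → EuclideanSpace ℝ (Fin 3) → EuclideanSpace ℝ (Fin 3))
    (p : ℝ → EuclideanSpace ℝ (Fin 3) → ℝ), IsClassicalNSSolutionOn (Set.Ico 0 T) ν 0 u p →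
    IsLerayHopfOn T ν 0 (u 0) u → HasRapidSpatialDecay (u 0) →
    ∃ A : ℝ, ∀ t ∈ Set.Ico 0 T, ∀ (x₀ : EuclideanSpace ℝ (Fin 3)) (r : ℝ), 0 < r →
      ∫⁻ x in ball x₀ r, ‖u t x‖ₑ ^ 2 ≤ ENNReal.ofReal (2 * r * A)

/-- D1 piece 2 — **in the Type-I-in-energy class, planar energies stay bounded** (per solution).
Enemies: the Type-I scar (`|x−x₀|⁻¹` tail, bounded scaled energy, log-divergent planar energy) and
the sparse coplanar archipelago; both are (L)-class (census §3, §4). -/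
def PlanarOfScaledEnergy : Prop :=
  ∀ (ν T : ℝ), 0 < ν → 0 < T → ∀ (u : ℝ → EuclideanSpace ℝ (Fin 3) → EuclideanSpace ℝ (Fin 3))
    (p : ℝ → EuclideanSpace ℝ (Fin 3) → ℝ), IsClassicalNSSolutionOn (Set.Ico 0 T) ν 0 u p →
    IsLerayHopfOn T ν 0 (u 0) u → HasRapidSpatialDecay (u 0) →
    (∃ A : ℝ, ∀ t ∈ Set.Ico 0 T, ∀ (x₀ : EuclideanSpace ℝ (Fin 3)) (r : ℝ), 0 < r →
      ∫⁻ x in ball x₀ r, ‖u t x‖ₑ ^ 2 ≤ ENNReal.ofReal (2 * r * A)) →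
    ∃ M : ℝ, ∀ t ∈ Set.Ico 0 T, ∀ (R : EuclideanSpace ℝ (Fin 3) ≃ₗᵢ[ℝ] EuclideanSpace ℝ (Fin 3)) (c : ℝ),
      ∫⁻ y : EuclideanSpace ℝ (Fin 2), ‖u t (R (WithLp.toLp 2 ![y 0, y 1, c]))‖ₑ ^ 2 ≤ ENNReal.ofReal M

/-- D1 assembly (trivial seam, modus ponens per solution). -/
theorem crux_of_d1 (h₁ : ScaledEnergyAPriori) (h₂ : PlanarOfScaledEnergy) : Crux :=
  fun ν T hν hT u p hcl hLH hdec => h₂ ν T hν hT u p hcl hLH hdec (h₁ ν T hν hT u p hcl hLH hdec)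

/-- D1 piece 1 is a consequence of the crux (landed calibration `PlanarEnergyAPriori.scaledEnergy_bound`). -/
theorem d1_piece1_of_crux (h : Crux) : ScaledEnergyAPriori := by
  intro ν T hν hT u p hcl hLH hdec
  obtain ⟨M, -, hM⟩ := PlanarEnergyAPriori.scaledEnergy_bound h hν hT hcl hLH hdec
  exact ⟨M, hM⟩

/-- D-H piece 1 — **global Hardy ceiling along frame solutions** (the frame-solution form of
HardyPointSink's crux `HardyEnergyBound`, stmt-7979: line-dead ×6 cycles, verdict open-problem class).
A CONSEQUENCE of the crux (`dh_piece1_of_crux`). -/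
def GlobalHardyCeilingFrame : Prop :=
  ∀ (ν T : ℝ), 0 < ν → 0 < T → ∀ (u : ℝ → EuclideanSpace ℝ (Fin 3) → EuclideanSpace ℝ (Fin 3))
    (p : ℝ → EuclideanSpace ℝ (Fin 3) → ℝ), IsClassicalNSSolutionOn (Set.Ico 0 T) ν 0 u p →
    IsLerayHopfOn T ν 0 (u 0) u → HasRapidSpatialDecay (u 0) →
    ∃ K : ℝ, ∀ t ∈ Set.Ico 0 T, ∀ x₀ : EuclideanSpace ℝ (Fin 3),
      ∫⁻ y, ‖u t y‖ₑ ^ 2 / ‖y - x₀‖ₑ ≤ ENNReal.ofReal K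

/-- D-H piece 2 — **Hardy-bounded frame solutions have bounded planar energies**. Under a Hardy bound
the scar and the planar-Type-II point are excluded KINEMATICALLY and macroscopic sheets by CKN (§B3);
the residual enemy is the sparse coplanar archipelago `N(r) → ∞`, `N(r) = o(1/r)` (census §3/§4),
(L)-class. -/
def PlanarOfHardy : Prop :=
  ∀ (ν T : ℝ), 0 < ν → 0 < T → ∀ (u : ℝ → EuclideanSpace ℝ (Fin 3) → EuclideanSpace ℝ (Fin 3))
    (p : ℝ → EuclideanSpace ℝ (Fin 3) → ℝ), IsClassicalNSSolutionOn (Set.Ico 0 T) ν 0 u p →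
    IsLerayHopfOn T ν 0 (u 0) u → HasRapidSpatialDecay (u 0) →
    (∃ K : ℝ, ∀ t ∈ Set.Ico 0 T, ∀ x₀ : EuclideanSpace ℝ (Fin 3),
      ∫⁻ y, ‖u t y‖ₑ ^ 2 / ‖y - x₀‖ₑ ≤ ENNReal.ofReal K) →
    ∃ M : ℝ, ∀ t ∈ Set.Ico 0 T, ∀ (R : EuclideanSpace ℝ (Fin 3) ≃ₗᵢ[ℝ] EuclideanSpace ℝ (Fin 3)) (c : ℝ),
      ∫⁻ y : EuclideanSpace ℝ (Fin 2), ‖u t (R (WithLp.toLp 2 ![y 0, y 1, c]))‖ₑ ^ 2 ≤ ENNReal.ofReal M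

/-- D-H assembly (trivial seam). -/
theorem crux_of_dh (h₁ : GlobalHardyCeilingFrame) (h₂ : PlanarOfHardy) : Crux :=
  fun ν T hν hT u p hcl hLH hdec => h₂ ν T hν hT u p hcl hLH hdec (h₁ ν T hν hT u p hcl hLH hdec)

/-- D-H piece 1 is a consequence of the crux (landed `PlanarEnergyAPriori.globalHardyCeiling`). -/
theorem dh_piece1_of_crux (h : Crux) : GlobalHardyCeilingFrame := by
  intro ν T hν hT u p hcl hLH hdec
  obtain ⟨K, -, hK⟩ := PlanarEnergyAPriori.globalHardyCeiling h hν hT hcl hLH hdec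
  exact ⟨K, hK⟩

/-- D3 middle piece — **in the Type-I-in-energy class, Hardy energies stay bounded** ("no scar":
excludes the `|x−x₀|⁻¹` final-time tail of a Type-I blow-up; (L)-class, cf. HardyPointSink 7979/7980). -/
def HardyOfScaledEnergy : Prop :=
  ∀ (ν T : ℝ), 0 < ν → 0 < T → ∀ (u : ℝ → EuclideanSpace ℝ (Fin 3) → EuclideanSpace ℝ (Fin 3))
    (p : ℝ → EuclideanSpace ℝ (Fin 3) → ℝ), IsClassicalNSSolutionOn (Set.Ico 0 T) ν 0 u p →
    IsLerayHopfOn T ν 0 (u 0) u → HasRapidSpatialDecay (u 0) →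
    (∃ A : ℝ, ∀ t ∈ Set.Ico 0 T, ∀ (x₀ : EuclideanSpace ℝ (Fin 3)) (r : ℝ), 0 < r →
      ∫⁻ x in ball x₀ r, ‖u t x‖ₑ ^ 2 ≤ ENNReal.ofReal (2 * r * A)) →
    ∃ K : ℝ, ∀ t ∈ Set.Ico 0 T, ∀ x₀ : EuclideanSpace ℝ (Fin 3),
      ∫⁻ y, ‖u t y‖ₑ ^ 2 / ‖y - x₀‖ₑ ≤ ENNReal.ofReal K

/-- D3 assembly: the three-enemy split (Type II ∣ scar ∣ sheets+archipelago). -/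
theorem crux_of_d3 (h₁ : ScaledEnergyAPriori) (h₂ : HardyOfScaledEnergy) (h₃ : PlanarOfHardy) : Crux :=
  fun ν T hν hT u p hcl hLH hdec =>
    h₃ ν T hν hT u p hcl hLH hdec (h₂ ν T hν hT u p hcl hLH hdec (h₁ ν T hν hT u p hcl hLH hdec))

/-! ## §B2 A sharper cross-route closing (PROVED): crux ∧ MorreyCellCriterion ⇒ summit -/

/-- **Planar ceiling + TerminalTrace's Morrey-cell criterion ⇒ the summit.** `MorreyCellCriterion`
(stmt-NavierStokesRegularity-18615, the `stub_morrey_cell` of TerminalTrace's registered skeleton for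
crux 18614) asks, at a top point `(T, x₀)` of a frame solution, for (i) a Type-I bound on the CKN scaled
energy `cknA r (T,x₀) u ≤ M` for small `r` and (ii) vanishing final density, and returns backward
boundedness. GIVEN the planar crux both inputs hold at EVERY top point: (i) by
`PlanarEnergyAPriori.scaledEnergy_bound` (all balls, all `t < T`; radii `r < √T` keep the backward
window inside `(0, T)`), (ii) by `noTraceConcentration_of_planarEnergyAPriori`. Hence every top point is
backward bounded and `BoundedEnvelope.stub_clayOfBackwardBounded` continues every Clay datum: the
route's regularity half may be weakened from 16856/16921 (or 18614, 7980) to 18615. -/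
theorem navierStokesRegularity_of_crux_of_morreyCellCriterion
    (h₁ : Theses.PlaneEnergyCeiling.PlanarEnergyAPriori) (h₂ : Theses.TerminalTrace.MorreyCellCriterion) :
    _root_.NavierStokesRegularity := by
  intro ν hν u₀ hsm hdiv hdec
  refine Theorems.BoundedEnvelope.stub_clayOfBackwardBounded ν hν u₀ hsm hdec hdiv ?_
  intro T hT u p hcl hLH h0 x₀
  have hLH' : IsLerayHopfOn T ν 0 (u 0) u := by rw [h0]; exact hLH
  have hdec' : HasRapidSpatialDecay (u 0) := by rw [h0]; exact hdec
  obtain ⟨M, -, hM⟩ := PlanarEnergyAPriori.scaledEnergy_bound h₁ hν hT hcl hLH' hdec'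
  have hA : ∃ (A : NNReal) (r₀ : ℝ), 0 < r₀ ∧ ∀ r : ℝ, 0 < r → r < r₀ → cknA r (T, x₀) u ≤ A := by
    refine ⟨(2 * M).toNNReal, Real.sqrt T, Real.sqrt_pos.2 hT, fun r hr hrT => ?_⟩
    have hsq : Real.sqrt T ^ 2 = T := Real.sq_sqrt hT.le
    have hr2 : r ^ 2 < T := by
      have h1 : r ^ 2 < Real.sqrt T ^ 2 := by
        exact pow_lt_pow_left₀ hrT hr.le two_ne_zero
      simpa [hsq] using h1
    show (⨆ t ∈ Set.Ioo (T - r ^ 2) T, (ENNReal.ofReal r)⁻¹ * ∫⁻ x in ball x₀ r, ‖u t x‖ₑ ^ 2) ≤ _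
    refine iSup₂_le fun t ht => ?_
    have htI : t ∈ Set.Ico 0 T := ⟨by linarith [ht.1], ht.2⟩
    have hb := hM t htI x₀ r hr
    calc (ENNReal.ofReal r)⁻¹ * ∫⁻ x in ball x₀ r, ‖u t x‖ₑ ^ 2
        ≤ (ENNReal.ofReal r)⁻¹ * ENNReal.ofReal (2 * r * M) := by gcongr
      _ = ENNReal.ofReal (2 * M) := by
          rw [show 2 * r * M = r * (2 * M) by ring, ENNReal.ofReal_mul hr.le, ← mul_assoc,
            ENNReal.inv_mul_cancel (ENNReal.ofReal_pos.2 hr).ne' ENNReal.ofReal_ne_top, one_mul]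
      _ = ((2 * M).toNNReal : ℝ≥0∞) := rfl
  exact h₂ ν T hν hT u p hcl hLH' hdec' x₀ hA
    (noTraceConcentration_of_planarEnergyAPriori h₁ ν T hν hT u p hcl hLH' hdec' x₀)

/-! ## §B1/B3/B4 Further typed consequences / reformulations (claimed; census §2, §4, §5) -/

/-- B1 — **energy continuity at the top time** (claimed consequence of the crux, census §5: CKN
`𝒫¹(Sing) = 0` makes the concentration defect of `|u(t)|² dx` at `t = T` live on an `H¹`-null set, and
the planar ceiling bounds the mass of every slab by its width, so the defect vanishes; with weak
continuity this is strong `L²` continuity at `T`, i.e. the energy equality holds on `[0, T]`). -/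
def EnergyContinuityAtTop : Prop :=
  ∀ (ν T : ℝ), 0 < ν → 0 < T → ∀ (u : ℝ → EuclideanSpace ℝ (Fin 3) → EuclideanSpace ℝ (Fin 3))
    (p : ℝ → EuclideanSpace ℝ (Fin 3) → ℝ), IsClassicalNSSolutionOn (Set.Ico 0 T) ν 0 u p →
    IsLerayHopfOn T ν 0 (u 0) u → HasRapidSpatialDecay (u 0) →
    Tendsto (fun t => ∫⁻ x, ‖u t x - u T x‖ₑ ^ 2) (𝓝[<] T) (𝓝 0)

/-- The claimed implication, as a Prop (NOT proved here; prover-sized given `ckn_partial_regularity_holds`). -/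
def CruxImpliesEnergyContinuity : Prop := Crux → EnergyContinuityAtTop

/-- B3 — **CKN in-plane islands** (claimed unconditional theorem, census §4: by compactness and
`H¹(Sing_T) = 0`, large velocities occupy in-plane sets of uniformly small area): for every `a₀ > 0`
there is a level `Λ` such that on every plane, inside the disc of radius `L`, at every `t < T`, the
superlevel set `{|u| ≥ Λ}` has area `≤ a₀`. -/
def InPlaneIslands : Prop :=
  ∀ (ν T : ℝ), 0 < ν → 0 < T → ∀ (u : ℝ → EuclideanSpace ℝ (Fin 3) → EuclideanSpace ℝ (Fin 3))
    (p : ℝ → EuclideanSpace ℝ (Fin 3) → ℝ), IsClassicalNSSolutionOn (Set.Ico 0 T) ν 0 u p →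
    IsLerayHopfOn T ν 0 (u 0) u → HasRapidSpatialDecay (u 0) →
    ∀ L a₀ : ℝ, 0 < L → 0 < a₀ → ∃ Λ : ℝ, ∀ t ∈ Set.Ico 0 T,
      ∀ (R : EuclideanSpace ℝ (Fin 3) ≃ₗᵢ[ℝ] EuclideanSpace ℝ (Fin 3)) (c : ℝ),
        volume {y : EuclideanSpace ℝ (Fin 2) | ‖y‖ < L ∧ Λ ≤ ‖u t (R (WithLp.toLp 2 ![y 0, y 1, c]))‖}
          ≤ ENNReal.ofReal a₀

/-- B4 — **single-direction planar ceiling** (planes normal to `e₃` only, no rotations). Census §2: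
it already implies `ScaledEnergyAPriori` (a ball of radius `r` lies in a slab of width `2r` of ANY
fixed direction), so dropping the `sup` over directions does not move the crux below the
Type-II-exclusion wall. -/
def SingleDirectionCeiling : Prop :=
  ∀ (ν T : ℝ), 0 < ν → 0 < T → ∀ (u : ℝ → EuclideanSpace ℝ (Fin 3) → EuclideanSpace ℝ (Fin 3))
    (p : ℝ → EuclideanSpace ℝ (Fin 3) → ℝ), IsClassicalNSSolutionOn (Set.Ico 0 T) ν 0 u p →
    IsLerayHopfOn T ν 0 (u 0) u → HasRapidSpatialDecay (u 0) →
    ∃ M : ℝ, ∀ t ∈ Set.Ico 0 T, ∀ c : ℝ,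
      ∫⁻ y : EuclideanSpace ℝ (Fin 2), ‖u t (WithLp.toLp 2 ![y 0, y 1, c])‖ₑ ^ 2 ≤ ENNReal.ofReal M

/-- The crux trivially gives the single-direction ceiling (`R = refl`). -/
theorem singleDirectionCeiling_of_crux (h : Crux) : SingleDirectionCeiling := by
  intro ν T hν hT u p hcl hLH hdec
  obtain ⟨M, hM⟩ := h ν T hν hT u p hcl hLH hdec
  refine ⟨M, fun t ht c => ?_⟩
  simpa using hM t ht (LinearIsometryEquiv.refl ℝ (EuclideanSpace ℝ (Fin 3))) c

end Summit.NavierStokesRegularity.NavierStokesRegularity.Cruxes.PlanarEnergyAPriori.StrategistR1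

end
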